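import Literature.NumberTheory.LFunctions.WeilLogLatticeComb
import Literature.NumberTheory.LFunctions.WeilGroundEnergyProofs
import HarnessLib

/-!
# The `L²` norm of a comb on the logarithmic lattice: separated teeth

Topic `Literature/NumberTheory/LFunctions`. For the comb
`g(u) = ∑_{m < N} c_m b((u - log m) λ)` (`Literature/NumberTheory/LFunctions/WeilLogLatticeComb.lean`)
built from a bump `b` supported in `[-1, 1]`, the tooth at `log m` lives on
`[log m - 1/λ, log m + 1/λ]`.  As long as the neighbouring lattice points are further than `2/λ`
away — which on the logarithmic lattice holds for all small `m` (`log(m+1) - log m ≥ 1/(m+1)`) —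
the teeth do not overlap, and the `L²` norm of `g` is at least the sum of the `L²` norms of the
separated teeth:

* `Literature.NumberTheory.LFunctions.integral_norm_sq_logComb_ge` —
  `(∑_{m ≤ m₀} |c_m|²) λ⁻¹ ‖b‖₂² ≤ ‖g‖₂²` whenever the teeth `1 ≤ m ≤ m₀` are `2/λ`-separated
  from every other tooth;
* `Literature.NumberTheory.LFunctions.abs_log_sub_log_gt_of_le` — the separation on the
  logarithmic lattice: `|log m' - log m| > 2/λ` for `m' ≠ m`, `1 ≤ m ≤ m₀`, `m' ≥ 1`, when
  `2(m₀ + 1) < λ`.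

Everything is proved; no named facts.

## References

* E. Bombieri, *Remarks on Weil's quadratic functional in the theory of prime numbers I* (2000), §4
  (norms of translated and dilated test functions).
-/

noncomputable section

open Complex MeasureTheory Set Filter Finset
open scoped Real Topology

namespace Literature.NumberTheory.LFunctions

/-- A bump supported in `[-1, 1]` vanishes at `x` with `|x| > 1`. [folklore] -/
theorem eq_zero_of_one_lt_abs {b : ℝ → ℂ} (hsupp : tsupport b ⊆ Set.Icc (-1) 1) {x : ℝ}
    (hx : 1 < |x|) : b x = 0 := by
  apply image_eq_zero_of_notMem_tsupport
  intro h
  have h' := hsupp h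
  rw [Set.mem_Icc] at h'
  have := abs_le.2 ⟨h'.1, h'.2⟩
  linarith

/-- If a bump supported in `[-1,1]` does not vanish at `x` then `|x| ≤ 1`. [folklore] -/
theorem abs_le_one_of_ne_zero {b : ℝ → ℂ} (hsupp : tsupport b ⊆ Set.Icc (-1) 1) {x : ℝ}
    (hx : b x ≠ 0) : |x| ≤ 1 := by
  by_contra h
  exact hx (eq_zero_of_one_lt_abs hsupp (not_le.1 h))

/-- `∫ ‖b((u - x) λ)‖² du = λ⁻¹ ∫ ‖b‖²` (`λ > 0`). [cite: Bombieri2000Weil, §4 proof of Thm 5] -/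
theorem integral_norm_sq_tooth (b : ℝ → ℂ) (x : ℝ) {lam : ℝ} (hlam : 0 < lam) :
    ∫ u, ‖b ((u - x) * lam)‖ ^ 2 = lam⁻¹ * ∫ u, ‖b u‖ ^ 2 := by
  have h1 := integral_sub_right_eq_self (μ := (volume : Measure ℝ))
    (fun y : ℝ ↦ ‖b (y * lam)‖ ^ 2) x
  rw [h1]
  have h2 := MeasureTheory.Measure.integral_comp_mul_right (fun y : ℝ ↦ ‖b y‖ ^ 2) lam
  rw [h2, smul_eq_mul, abs_of_pos (inv_pos.2 hlam)]

/-- **Separated teeth give a lower bound for the norm of a comb.** Let `b` be a test function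
supported in `[-1, 1]`, `λ > 0`, `c_0 = 0`, `m₀ < N`, and suppose that every tooth
`1 ≤ m ≤ m₀` is `2/λ`-separated from every other tooth: `|log m' - log m| > 2/λ` for
`m' < N`, `m' ≠ m`, `m' ≠ 0`. Then
`(∑_{m=1}^{m₀} ‖c_m‖²) λ⁻¹ ∫ ‖b‖² ≤ ∫ ‖∑_{m<N} c_m b((u - log m)λ)‖² du`.
[cite: Bombieri2000Weil, §4 proof of Thm 5] -/
theorem integral_norm_sq_logComb_ge {b : ℝ → ℂ} (hb : IsWeilTest b)
    (hsupp : tsupport b ⊆ Set.Icc (-1) 1) {c : ℕ → ℂ} (hc0 : c 0 = 0) {N m₀ : ℕ} (hm₀ : m₀ < N)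
    {lam : ℝ} (hlam : 0 < lam)
    (hsep : ∀ m ∈ Finset.Icc 1 m₀, ∀ m' ∈ Finset.range N, m' ≠ m → m' ≠ 0 →
      2 / lam < |Real.log m' - Real.log m|) :
    (∑ m ∈ Finset.Icc 1 m₀, ‖c m‖ ^ 2) * (lam⁻¹ * ∫ u, ‖b u‖ ^ 2)
      ≤ ∫ u, ‖∑ m ∈ Finset.range N, c m * b ((u - Real.log m) * lam)‖ ^ 2 := by
  classical
  set g : ℝ → ℂ := fun u ↦ ∑ m ∈ Finset.range N, c m * b ((u - Real.log m) * lam) with hg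
  set H : ℝ → ℝ := fun u ↦ ∑ m ∈ Finset.Icc 1 m₀, ‖c m‖ ^ 2 * ‖b ((u - Real.log m) * lam)‖ ^ 2
    with hH
  have hIcc : ∀ m ∈ Finset.Icc 1 m₀, m ∈ Finset.range N ∧ m ≠ 0 := fun m hm ↦ by
    simp only [Finset.mem_Icc, Finset.mem_range] at hm ⊢; omega
  -- if the tooth at `m` is active at `u`, every other tooth vanishes at `u`
  have hvanish : ∀ u : ℝ, ∀ m ∈ Finset.Icc 1 m₀, b ((u - Real.log m) * lam) ≠ 0 →
      ∀ m' ∈ Finset.range N, m' ≠ m → c m' * b ((u - Real.log m') * lam) = 0 := by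
    intro u m hm hne m' hm' hm'm
    rcases Nat.eq_zero_or_pos m' with h0 | hpos
    · subst h0; simp [hc0]
    · have hact := abs_le_one_of_ne_zero hsupp hne
      have hfar := hsep m hm m' hm' hm'm hpos.ne'
      have hout : 1 < |(u - Real.log m') * lam| := by
        have e : (u - Real.log m') * lam
            = (u - Real.log m) * lam - (Real.log m' - Real.log m) * lam := by ring
        rw [e]
        have h1 : |(Real.log m' - Real.log m) * lam| > 2 := by
          rw [abs_mul, abs_of_pos hlam]
          have := (div_lt_iff₀ hlam).1 hfar
          linarith
        have h2 := abs_sub_abs_le_abs_sub ((Real.log m' - Real.log m) * lam) ((u - Real.log m) * lam)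
        rw [abs_sub_comm] at h2
        linarith
      rw [eq_zero_of_one_lt_abs hsupp hout, mul_zero]
  -- pointwise: `H u ≤ ‖g u‖²`
  have hpt : ∀ u, H u ≤ ‖g u‖ ^ 2 := by
    intro u
    by_cases hex : ∃ m ∈ Finset.Icc 1 m₀, b ((u - Real.log m) * lam) ≠ 0
    · obtain ⟨m, hm, hne⟩ := hex
      have hmN := (hIcc m hm).1
      have hgu : g u = c m * b ((u - Real.log m) * lam) := by
        simp only [hg]
        exact Finset.sum_eq_single_of_mem m hmN fun m' hm' hm'm ↦ hvanish u m hm hne m' hm' hm'm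
      have hHu : H u = ‖c m‖ ^ 2 * ‖b ((u - Real.log m) * lam)‖ ^ 2 := by
        simp only [hH]
        refine Finset.sum_eq_single_of_mem m hm fun m' hm' hm'm ↦ ?_
        have h := hvanish u m hm hne m' (hIcc m' hm').1 hm'm
        rcases mul_eq_zero.1 h with h1 | h1
        · simp [h1]
        · simp [h1]
      rw [hHu, hgu, norm_mul, mul_pow]
    · push Not at hex
      have hHu : H u = 0 := by
        simp only [hH]
        exact Finset.sum_eq_zero fun m hm ↦ by simp [hex m hm]
      rw [hHu]; positivity
  -- integrability
  have hgt : IsWeilTest g := isWeilTest_logComb hb c N hlam.ne'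
  have hgi : Integrable fun u ↦ ‖g u‖ ^ 2 := hgt.integrable_norm_sq
  have htooth : ∀ m : ℕ, Integrable fun u ↦ ‖b ((u - Real.log m) * lam)‖ ^ 2 := by
    intro m
    have h := (isWeilTest_tooth hb 1 (Real.log m) hlam.ne').integrable_norm_sq
    simpa using h
  have hHi : Integrable H := by
    simp only [hH]
    exact integrable_finsetSum _ fun m _ ↦ (htooth m).const_mul _
  -- integrate
  have hint : ∫ u, H u ≤ ∫ u, ‖g u‖ ^ 2 := integral_mono hHi hgi hpt
  have hHint : ∫ u, H u = (∑ m ∈ Finset.Icc 1 m₀, ‖c m‖ ^ 2) * (lam⁻¹ * ∫ u, ‖b u‖ ^ 2) := by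
    simp only [hH]
    rw [integral_finsetSum _ fun m _ ↦ (htooth m).const_mul _, Finset.sum_mul]
    refine Finset.sum_congr rfl fun m _ ↦ ?_
    rw [integral_const_mul, integral_norm_sq_tooth b (Real.log m) hlam]
  rw [← hHint]
  exact hint

/-- **Separation on the logarithmic lattice**: if `2(m₀+1) < λ`, `1 ≤ m ≤ m₀` and `m' ≥ 1`,
`m' ≠ m`, then `|log m' - log m| > 2/λ` (since `|log m' - log m| ≥ log((m+1)/m) ≥ 1/(m+1)`).
[folklore] -/
theorem abs_log_sub_log_gt_of_le {lam : ℝ} {m₀ m m' : ℕ} (hsep : 2 * ((m₀ : ℝ) + 1) < lam)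
    (hm1 : 1 ≤ m) (hm : m ≤ m₀) (hm'1 : 1 ≤ m') (hne : m' ≠ m) :
    2 / lam < |Real.log m' - Real.log m| := by
  have hlam0 : 0 < lam := by
    have : (0 : ℝ) ≤ m₀ := Nat.cast_nonneg m₀; linarith
  have hmR : (1 : ℝ) ≤ m := by exact_mod_cast hm1
  have hm0 : (0 : ℝ) < m := by linarith
  have hm'0 : (0 : ℝ) < m' := by exact_mod_cast hm'1
  -- `1/(m+1) > 2/λ`
  have hkey : 2 / lam < 1 / ((m : ℝ) + 1) := by
    rw [div_lt_div_iff₀ hlam0 (by linarith)]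
    have : (m : ℝ) ≤ m₀ := by exact_mod_cast hm
    nlinarith
  refine hkey.trans_le ?_
  rcases lt_or_gt_of_ne hne with hlt | hgt
  · -- `m' < m`: `log m - log m' ≥ log m - log (m-1) ≥ 1/m ≥ 1/(m+1)`
    have hm2 : 2 ≤ m := by omega
    have hm'le : (m' : ℝ) ≤ m - 1 := by
      have : m' ≤ m - 1 := by omega
      have h := (Nat.cast_le (α := ℝ)).2 this
      rw [Nat.cast_sub (by omega)] at h
      simpa using h
    have hm1pos : (0 : ℝ) < m - 1 := by
      have : (2 : ℝ) ≤ m := by exact_mod_cast hm2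
      linarith
    have h1 : Real.log m' ≤ Real.log ((m : ℝ) - 1) := Real.log_le_log hm'0 hm'le
    have h2 : 1 / (m : ℝ) ≤ Real.log m - Real.log ((m : ℝ) - 1) := by
      have := Real.one_sub_inv_le_log_of_pos (x := (m : ℝ) / (m - 1)) (by positivity)
      rw [Real.log_div hm0.ne' hm1pos.ne', inv_div] at this
      have e : 1 - ((m : ℝ) - 1) / m = 1 / m := by field_simp; ring
      linarith
    have h3 : 1 / ((m : ℝ) + 1) ≤ 1 / m := one_div_le_one_div_of_le hm0 (by linarith)
    have h4 : 0 < 1 / ((m : ℝ) + 1) := by positivity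
    rw [abs_sub_comm, abs_of_nonneg (by linarith)]
    linarith
  · -- `m' > m`: `log m' - log m ≥ log (m+1) - log m ≥ 1/(m+1)`
    have hm'ge : (m : ℝ) + 1 ≤ m' := by exact_mod_cast hgt
    have h1 : Real.log ((m : ℝ) + 1) ≤ Real.log m' := Real.log_le_log (by linarith) hm'ge
    have h2 : 1 / ((m : ℝ) + 1) ≤ Real.log ((m : ℝ) + 1) - Real.log m := by
      have := Real.one_sub_inv_le_log_of_pos (x := ((m : ℝ) + 1) / m) (by positivity)
      rw [Real.log_div (by linarith) hm0.ne', inv_div] at this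
      have e : 1 - (m : ℝ) / (m + 1) = 1 / (m + 1) := by field_simp; ring
      linarith
    have h4 : 0 < 1 / ((m : ℝ) + 1) := by positivity
    rw [abs_of_nonneg (by linarith)]
    linarith

end Literature.NumberTheory.LFunctions
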